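import Mathlib
import Literature.LinearAlgebra.Alternating.WedgeWordsBasis
import Summits.HodgeConjecture.HodgeConjecture.Theorems.TropicalKugaSatakeCayleyCayleyHodgeRankTwoSlotLeibniz

/-!
# Route `TropicalKugaSatakeCayley`, support S5 `CayleyHodgeRankTwo` (stmt-HodgeConjecture-18573) — part B7:
# transfer of flatness and rationality through the Lefschetz operator

Generic CAR bookkeeping for the Lefschetz operator `L η = Σᵢ θᵢ ∧ (θ'ᵢ ∧ η)` of a split frame
(`θᵢ = e^i`, `θ'ᵢ = f^i` real covectors; `Literature…wedgeOne`) acting on `ℂ`-valued constant forms of a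
real normed space `V`, and a continuous linear operator `N` on `V`:

* `tkc_slotSum_smul_op` — the slotwise derivation along `r • N` is `r` times that along `N`;
* `tkc_slotSum_lef` — if the slotwise derivation of `η` along `N` vanishes identically, that of `L η` is
  the evaluation of `Σᵢ ((θᵢ ∘ N) ∧ θ'ᵢ ∧ η + θᵢ ∧ (θ'ᵢ ∘ N) ∧ η)` (Leibniz, part B4, twice);
* `tkc_symN_raise_apply_eq_zero` / `tkc_symN_lower_apply_eq_zero` — that form VANISHES when `N` is a
  raising operator (`θᵢ ∘ N = Σ_q B_{iq} θ'_q`, `θ'ᵢ ∘ N = 0`) or a lowering operator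
  (`θᵢ ∘ N = 0`, `θ'ᵢ ∘ N = Σ_q C_{iq} θ_q`) with a SYMMETRIC matrix — the symmetric matrix pairs off
  against the antisymmetry `θ ∧ θ' ∧ ζ = -θ' ∧ θ ∧ ζ` (`wedgeOne_wedgeOne_add_swap`); this is
  `[D_N, L] = 0`, i.e. `D_N θ = 0` for the symplectic form `θ = Σ e^i ∧ f^i` of a symmetric period matrix;
* `tkc_flat_lef_raise` / `tkc_flat_lef_lower` — hence flatness along the ten cusp operators passes from
  `η` to `L η` (and so from the `(2,2)`-tables of part B3 to their `L⁴`-images, the `(6,6)`-forms of S5);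
* `tkc_frameWord_apply_vec_mem_range`, `tkc_wedgeOne_apply_vec_mem_range` — rational (indeed integral)
  values on words of frame vectors are preserved by `θ ∧ ·` for integral `θ`, the rationality input of the
  transport (part C).

Theorems only: no definition, no named fact, no sorry.

## References

* [Warner1983] F. W. Warner, Foundations of Differentiable Manifolds and Lie Groups (1983), 2.6, 2.11.
* [LangeBirkenhake1992] H. Lange, Ch. Birkenhake, Complex Abelian Varieties (1992), §1.1.3–1.1.5 (the
  symplectic form of a period matrix; Hodge forms of a polarised torus).
-/

noncomputable section

set_option linter.dupNamespace false

namespace Summit.HodgeConjecture.HodgeConjecture.Theorems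

open Literature.LinearAlgebra.Alternating

section Transfer

variable {V : Type*} [NormedAddCommGroup V] [NormedSpace ℝ V]

/-- **Scaling the operator scales the slotwise derivation**: along `r • N` it is `r` times that along `N`.
[folklore] -/
theorem tkc_slotSum_smul_op {k : ℕ} (r : ℝ) (N : V →L[ℝ] V) (η : V [⋀^Fin k]→L[ℝ] ℂ) (u : Fin k → V) :
    ∑ m, η (Function.update u m ((r • N) (u m))) = r • ∑ m, η (Function.update u m (N (u m))) := by
  classical
  rw [Finset.smul_sum]
  refine Finset.sum_congr rfl fun m _ => ?_
  rw [_root_.smul_apply, ContinuousAlternatingMap.map_update_smul]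

/-- A form that is zero vanishes at every tuple (bookkeeping for the certificate files). [folklore] -/
theorem tkc_apply_eq_zero_of_eq_zero {k : ℕ} {f : V [⋀^Fin k]→L[ℝ] ℂ} (h : f = 0) (u : Fin k → V) :
    f u = 0 := by
  rw [h]
  rfl

/-- Flatness along `N` gives flatness along every multiple `r • N`. [folklore] -/
theorem tkc_flat_smul_op {k : ℕ} (r : ℝ) (N : V →L[ℝ] V) (η : V [⋀^Fin k]→L[ℝ] ℂ)
    (hη : ∀ u : Fin k → V, ∑ m, η (Function.update u m (N (u m))) = 0) (u : Fin k → V) :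
    ∑ m, η (Function.update u m ((r • N) (u m))) = 0 := by
  rw [tkc_slotSum_smul_op, hη u, smul_zero]

variable {ι : Type*} [Fintype ι] (θ θ' : ι → (V →L[ℝ] ℝ))

/-- **Slotwise derivation of `L η = Σᵢ θᵢ ∧ θ'ᵢ ∧ η` for a flat `η`**: it is the evaluation of
`Σᵢ ((θᵢ ∘ N) ∧ θ'ᵢ ∧ η + θᵢ ∧ (θ'ᵢ ∘ N) ∧ η)` (the Leibniz rule of part B4 twice; the third Leibniz
term is the slotwise derivation of `η`, which vanishes). [cite: Warner1983, 2.11] -/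
theorem tkc_slotSum_lef {n : ℕ} (N : V →L[ℝ] V) (η : V [⋀^Fin n]→L[ℝ] ℂ)
    (hη : ∀ v : Fin n → V, ∑ m, η (Function.update v m (N (v m))) = 0) (u : Fin (n + 1 + 1) → V) :
    ∑ m, (∑ i, wedgeOne (θ i) (wedgeOne (θ' i) η)) (Function.update u m (N (u m))) =
      (∑ i, (wedgeOne ((θ i).comp N) (wedgeOne (θ' i) η) +
        wedgeOne (θ i) (wedgeOne ((θ' i).comp N) η))) u := by
  simp only [ContinuousAlternatingMap.sum_apply, ContinuousAlternatingMap.add_apply]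
  rw [Finset.sum_comm]
  refine Finset.sum_congr rfl fun i _ => ?_
  rw [tkc_slotSum_wedgeOne]
  congr 1
  have hinner : ∀ w : Fin (n + 1) → V,
      ∑ m, wedgeOne (θ' i) η (Function.update w m (N (w m))) = wedgeOne ((θ' i).comp N) η w := by
    intro w
    rw [tkc_slotSum_wedgeOne]
    simp only [hη, smul_zero, Finset.sum_const_zero, add_zero]
  simp only [hinner]
  rw [wedgeOne_apply]

/-- **Symmetric coefficients against antisymmetric double wedges cancel**:
`Σᵢ Σ_q B_{iq} · (φ_q ∧ φ_i ∧ ζ)(v) = 0` for a symmetric `B`. [cite: Warner1983, 2.6] -/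
theorem tkc_sum_symm_wedge_wedge_apply_eq_zero {n : ℕ} (φ : ι → (V →L[ℝ] ℝ)) (B : ι → ι → ℝ)
    (hB : ∀ i q, B i q = B q i) (ζ : V [⋀^Fin n]→L[ℝ] ℂ) (v : Fin (n + 1 + 1) → V) :
    (∑ i, ∑ q, B i q • wedgeOne (φ q) (wedgeOne (φ i) ζ) v) = 0 := by
  have hX : ∀ i q, wedgeOne (φ q) (wedgeOne (φ i) ζ) v = -wedgeOne (φ i) (wedgeOne (φ q) ζ) v := by
    intro i q
    have h := congrArg (fun f : V [⋀^Fin (n + 1 + 1)]→L[ℝ] ℂ => f v)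
      (wedgeOne_wedgeOne_add_swap (φ q) (φ i) ζ)
    simp only [ContinuousAlternatingMap.add_apply, ContinuousAlternatingMap.coe_zero, Pi.zero_apply] at h
    exact eq_neg_of_add_eq_zero_left h
  set S := ∑ i, ∑ q, B i q • wedgeOne (φ q) (wedgeOne (φ i) ζ) v with hS
  have hneg : S = -S := by
    calc S = ∑ i, ∑ q, B q i • wedgeOne (φ i) (wedgeOne (φ q) ζ) v := by
            rw [hS, Finset.sum_comm]
      _ = ∑ i, ∑ q, -(B i q • wedgeOne (φ q) (wedgeOne (φ i) ζ) v) := by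
            refine Finset.sum_congr rfl fun i _ => Finset.sum_congr rfl fun q _ => ?_
            rw [← hB i q, hX q i, smul_neg]
      _ = -S := by simp only [Finset.sum_neg_distrib, hS]
  have h2 : S + S = 0 := by
    nth_rewrite 2 [hneg]
    exact add_neg_cancel S
  exact add_self_eq_zero.mp h2

/-- **`[D_N, L] = 0` for a raising operator**: if `θᵢ ∘ N = Σ_q B_{iq} θ'_q` with `B` symmetric and
`θ'ᵢ ∘ N = 0`, then `Σᵢ ((θᵢ ∘ N) ∧ θ'ᵢ ∧ η + θᵢ ∧ (θ'ᵢ ∘ N) ∧ η) = 0` (pointwise).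
[cite: LangeBirkenhake1992, §1.1.5] -/
theorem tkc_symN_raise_apply_eq_zero {n : ℕ} (N : V →L[ℝ] V) (B : ι → ι → ℝ) (hB : ∀ i q, B i q = B q i)
    (hθ : ∀ i x, θ i (N x) = ∑ q, B i q * θ' q x) (hθ' : ∀ i x, θ' i (N x) = 0)
    (η : V [⋀^Fin n]→L[ℝ] ℂ) (v : Fin (n + 1 + 1) → V) :
    (∑ i, (wedgeOne ((θ i).comp N) (wedgeOne (θ' i) η) +
      wedgeOne (θ i) (wedgeOne ((θ' i).comp N) η))) v = 0 := by
  -- the second summands vanish termwise, the first are `Σ_q B_{iq} (θ'_q ∧ θ'_i ∧ η)(v)`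
  have h1 : ∀ i, wedgeOne ((θ i).comp N) (wedgeOne (θ' i) η) v =
      ∑ q, B i q • wedgeOne (θ' q) (wedgeOne (θ' i) η) v := by
    intro i
    have hr : ∀ q, B i q • wedgeOne (θ' q) (wedgeOne (θ' i) η) v =
        ∑ a : Fin (n + 1 + 1), B i q • ((-1) ^ (a : ℕ) • θ' q (v a) • wedgeOne (θ' i) η (a.removeNth v)) := by
      intro q
      rw [wedgeOne_apply, Finset.smul_sum]
    simp only [hr]
    rw [wedgeOne_apply, Finset.sum_comm]
    refine Finset.sum_congr rfl fun a _ => ?_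
    rw [ContinuousLinearMap.comp_apply, hθ, Finset.sum_smul, Finset.smul_sum]
    refine Finset.sum_congr rfl fun q _ => ?_
    rw [mul_smul]
    exact smul_comm _ _ _
  have h2 : ∀ i, wedgeOne (θ i) (wedgeOne ((θ' i).comp N) η) v = 0 := by
    intro i
    simp only [wedgeOne_apply, ContinuousLinearMap.comp_apply, hθ', zero_smul, Finset.sum_const_zero,
      smul_zero]
  simp only [ContinuousAlternatingMap.sum_apply, ContinuousAlternatingMap.add_apply, h1, h2, add_zero]
  exact tkc_sum_symm_wedge_wedge_apply_eq_zero θ' B hB η v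

/-- **`[D_N, L] = 0` for a lowering operator**: if `θᵢ ∘ N = 0` and `θ'ᵢ ∘ N = Σ_q C_{iq} θ_q` with `C`
symmetric, then `Σᵢ ((θᵢ ∘ N) ∧ θ'ᵢ ∧ η + θᵢ ∧ (θ'ᵢ ∘ N) ∧ η) = 0` (pointwise).
[cite: LangeBirkenhake1992, §1.1.5] -/
theorem tkc_symN_lower_apply_eq_zero {n : ℕ} (N : V →L[ℝ] V) (C : ι → ι → ℝ) (hC : ∀ i q, C i q = C q i)
    (hθ : ∀ i x, θ i (N x) = 0) (hθ' : ∀ i x, θ' i (N x) = ∑ q, C i q * θ q x)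
    (η : V [⋀^Fin n]→L[ℝ] ℂ) (v : Fin (n + 1 + 1) → V) :
    (∑ i, (wedgeOne ((θ i).comp N) (wedgeOne (θ' i) η) +
      wedgeOne (θ i) (wedgeOne ((θ' i).comp N) η))) v = 0 := by
  have h1 : ∀ i, wedgeOne ((θ i).comp N) (wedgeOne (θ' i) η) v = 0 := by
    intro i
    simp only [wedgeOne_apply, ContinuousLinearMap.comp_apply, hθ, zero_smul, smul_zero,
      Finset.sum_const_zero]
  have hinner : ∀ i (w : Fin (n + 1) → V), wedgeOne ((θ' i).comp N) η w =
      ∑ q, C i q • wedgeOne (θ q) η w := by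
    intro i w
    simp only [wedgeOne_apply, ContinuousLinearMap.comp_apply, hθ', Finset.sum_smul, mul_smul,
      Finset.smul_sum]
    rw [Finset.sum_comm]
    refine Finset.sum_congr rfl fun q _ => Finset.sum_congr rfl fun a _ => ?_
    exact smul_comm _ _ _
  have h2 : ∀ i, wedgeOne (θ i) (wedgeOne ((θ' i).comp N) η) v =
      ∑ q, C i q • wedgeOne (θ i) (wedgeOne (θ q) η) v := by
    intro i
    rw [wedgeOne_apply]
    simp only [hinner, Finset.smul_sum]
    rw [Finset.sum_comm]
    refine Finset.sum_congr rfl fun q _ => ?_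
    rw [wedgeOne_apply, Finset.smul_sum]
    refine Finset.sum_congr rfl fun a _ => ?_
    rw [smul_comm (θ i (v a)) (C i q) _]
    exact smul_comm _ _ _
  simp only [ContinuousAlternatingMap.sum_apply, ContinuousAlternatingMap.add_apply, h1, h2, zero_add]
  rw [Finset.sum_comm]
  have hflip : (∑ q, ∑ i, C i q • wedgeOne (θ i) (wedgeOne (θ q) η) v) =
      ∑ q, ∑ i, C q i • wedgeOne (θ i) (wedgeOne (θ q) η) v := by
    refine Finset.sum_congr rfl fun q _ => Finset.sum_congr rfl fun i _ => ?_
    rw [hC i q]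
  rw [hflip]
  exact tkc_sum_symm_wedge_wedge_apply_eq_zero θ C hC η v

/-- **Flatness passes through `L` along a raising operator.** [cite: LangeBirkenhake1992, §1.1.5] -/
theorem tkc_flat_lef_raise {n : ℕ} (N : V →L[ℝ] V) (B : ι → ι → ℝ) (hB : ∀ i q, B i q = B q i)
    (hθ : ∀ i x, θ i (N x) = ∑ q, B i q * θ' q x) (hθ' : ∀ i x, θ' i (N x) = 0)
    (η : V [⋀^Fin n]→L[ℝ] ℂ) (hη : ∀ v : Fin n → V, ∑ m, η (Function.update v m (N (v m))) = 0)
    (u : Fin (n + 1 + 1) → V) :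
    ∑ m, (∑ i, wedgeOne (θ i) (wedgeOne (θ' i) η)) (Function.update u m (N (u m))) = 0 := by
  rw [tkc_slotSum_lef θ θ' N η hη u, tkc_symN_raise_apply_eq_zero θ θ' N B hB hθ hθ' η u]

/-- **Flatness passes through `L` along a lowering operator.** [cite: LangeBirkenhake1992, §1.1.5] -/
theorem tkc_flat_lef_lower {n : ℕ} (N : V →L[ℝ] V) (C : ι → ι → ℝ) (hC : ∀ i q, C i q = C q i)
    (hθ : ∀ i x, θ i (N x) = 0) (hθ' : ∀ i x, θ' i (N x) = ∑ q, C i q * θ q x)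
    (η : V [⋀^Fin n]→L[ℝ] ℂ) (hη : ∀ v : Fin n → V, ∑ m, η (Function.update v m (N (v m))) = 0)
    (u : Fin (n + 1 + 1) → V) :
    ∑ m, (∑ i, wedgeOne (θ i) (wedgeOne (θ' i) η)) (Function.update u m (N (u m))) = 0 := by
  rw [tkc_slotSum_lef θ θ' N η hη u, tkc_symN_lower_apply_eq_zero θ θ' N C hC hθ hθ' η u]

end Transfer

section Rationality

variable {V : Type*} [NormedAddCommGroup V] [NormedSpace ℝ V] {ι' : Type*} (bv : ι' → V)

/-- **`θ ∧ η` takes rational values on words of frame vectors** when `θ` is integral on the frame vectors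
and `η` is rational on words of frame vectors. [cite: LangeBirkenhake1992, §1.1.4] -/
theorem tkc_wedgeOne_apply_vec_mem_range {n : ℕ} (θ : V →L[ℝ] ℝ) (hθ : ∀ a, ∃ m : ℤ, θ (bv a) = m)
    (η : V [⋀^Fin n]→L[ℝ] ℂ) (hη : ∀ w : Fin n → ι', η (bv ∘ w) ∈ Set.range (algebraMap ℚ ℂ))
    (u : Fin (n + 1) → ι') : wedgeOne θ η (bv ∘ u) ∈ Set.range (algebraMap ℚ ℂ) := by
  rw [wedgeOne_apply, ← RingHom.coe_range]
  refine Subring.sum_mem _ fun i _ => ?_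
  obtain ⟨m, hm⟩ := hθ (u i)
  obtain ⟨q, hq⟩ := hη (i.removeNth u)
  have hrem : i.removeNth (bv ∘ u) = bv ∘ i.removeNth u := rfl
  rw [hrem, ← hq, Function.comp_apply, hm, zsmul_eq_mul, Complex.real_smul]
  refine ⟨(-1) ^ (i : ℕ) * m * q, ?_⟩
  simp only [map_mul, map_pow, map_neg, map_one, map_intCast, Int.cast_pow, Int.cast_neg, Int.cast_one,
    Complex.ofReal_intCast]
  ring

/-- The sum `Σᵢ θᵢ ∧ (θ'ᵢ ∧ η)` takes rational values on words of frame vectors when the `θᵢ, θ'ᵢ` are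
integral on frame vectors and `η` is rational on words of frame vectors. [cite: LangeBirkenhake1992, §1.1.4] -/
theorem tkc_lef_apply_vec_mem_range {ι : Type*} [Fintype ι] (θ θ' : ι → (V →L[ℝ] ℝ))
    (hθ : ∀ i a, ∃ m : ℤ, θ i (bv a) = m) (hθ' : ∀ i a, ∃ m : ℤ, θ' i (bv a) = m)
    {n : ℕ} (η : V [⋀^Fin n]→L[ℝ] ℂ) (hη : ∀ w : Fin n → ι', η (bv ∘ w) ∈ Set.range (algebraMap ℚ ℂ))
    (u : Fin (n + 1 + 1) → ι') :
    (∑ i, wedgeOne (θ i) (wedgeOne (θ' i) η)) (bv ∘ u) ∈ Set.range (algebraMap ℚ ℂ) := by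
  rw [ContinuousAlternatingMap.sum_apply, ← RingHom.coe_range]
  refine Subring.sum_mem _ fun i _ => ?_
  exact tkc_wedgeOne_apply_vec_mem_range bv (θ i) (hθ i) _
    (fun w => tkc_wedgeOne_apply_vec_mem_range bv (θ' i) (hθ' i) η hη w) u

variable [DecidableEq ι'] (θ₀ : ι' → (V →L[ℝ] ℝ)) (hdual : ∀ i j, θ₀ i (bv j) = if i = j then 1 else 0)

include hdual in
/-- **An increasing monomial of a dual frame takes integral values on every word of frame vectors**
(the determinant of a `0/1` pairing matrix). [cite: Warner1983, 2.6] -/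
theorem tkc_frameWord_apply_vec_mem_range {k : ℕ} (w u : Fin k → ι') :
    frameWord ℂ θ₀ k w (bv ∘ u) ∈ Set.range (algebraMap ℚ ℂ) := by
  rw [frameWord_eq, wedgeWord_apply]
  have hM : pairingMatrix (fun i => (θ₀ i).smulRight (1 : ℂ)) w (bv ∘ u) =
      (Matrix.of fun i j => if w i = u j then (1 : ℚ) else 0).map (algebraMap ℚ ℂ) := by
    ext i j
    rw [pairingMatrix_apply, Matrix.map_apply, Matrix.of_apply, ContinuousLinearMap.smulRight_apply,
      Function.comp_apply, hdual]
    split_ifs <;> simp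
  rw [hM, ← RingHom.mapMatrix_apply, ← RingHom.map_det]
  refine ⟨(Matrix.of fun i j => if w i = u j then (1 : ℚ) else 0).det, ?_⟩
  simp [ContinuousAlternatingMap.constOfIsEmpty_apply]

include hdual in
/-- **An integral monomial table takes rational values on every word of frame vectors.**
[cite: LangeBirkenhake1992, §1.1.4] -/
theorem tkc_table_apply_vec_mem_range {k m : ℕ} (word : Fin m → (Fin k → ι'))
    (coef : Fin m → ℤ) (u : Fin k → ι') :
    (∑ t, (coef t : ℂ) • frameWord ℂ θ₀ k (word t)) (bv ∘ u) ∈ Set.range (algebraMap ℚ ℂ) := by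
  rw [ContinuousAlternatingMap.sum_apply, ← RingHom.coe_range]
  refine Subring.sum_mem _ fun t _ => ?_
  rw [ContinuousAlternatingMap.smul_apply, smul_eq_mul]
  refine Subring.mul_mem _ ⟨(coef t : ℚ), by simp⟩ ?_
  exact tkc_frameWord_apply_vec_mem_range bv θ₀ hdual (word t) u

end Rationality

end Summit.HodgeConjecture.HodgeConjecture.Theorems

end
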